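import Literature.NumberTheory.Automorphic.ResGLnKugaCasimirScalarE
import Literature.Algebra.Lie.ChevalleyEilenbergPairedPrimitive
import HarnessLib

/-!
# A basic non-trivial cuspidal cocycle has no horizontal paired primitive of moderate growth
# (Borel's injectivity of cuspidal cohomology, reduced to the existence of the primitive)

Topic `NumberTheory/Automorphic`; namespaces `Literature.NumberTheory.Automorphic.Kuga` (the
two-module tensor pairing) and `…ConeDictionary`.  Definitions with bodies and theorems; no named
fact, no `sorry`.

Step 4 of Borel's proof of the injectivity of cuspidal cohomology (`ResGLnCuspidalCohomologyApex`,
fact `Borel1983_coneClass_ne_zero`) in the abstract form of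
`ChevalleyEilenbergPairedPrimitive.eq_zero_of_pairedPrimitive`, with every `K_∞`-side input of the
tree plugged in (`ResGLnKugaCasimirScalarE.coclosed_of_cuspidal`):

* `Kuga.IsSesqPairing`, `Kuga.tensorPairing p b` — a sesquilinear pairing `p : W' × W → ℂ`
  extended to `(W' ⊗ E) × (W ⊗ E)` along a basis `b` of `E` (`tensorPairing_map_left_rTensor`,
  `tensorPairing_map_left_lTensor(_of_orthonormal)`, `tensorPairing_rTensor_of_extends`,
  `IsSesqPairing.rePairing`);
* for an auxiliary Lie module `W'` of the Lie algebra of the datum (in the application: smooth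
  functions of uniform moderate growth on `G(K)\G(𝔸)` with the central character of `π`, acted on
  by Lie derivatives) and `p` extending the Petersson form of `π` and skew along the trace-zero
  Hermitian `x i` (integration by parts of a function of moderate growth against a cusp form,
  `AutomorphicLieDerivSkewAdjointModerateGrowth`): `pairingForm`, `pairP` (`= Re pairingForm` on
  `(W' ⊗ E_λ) × (W ⊗ E_λ)`), `pairP_lie` (the adjunction `hadjP`), `pairP_incl` (`hj`), `inclT`
  (`j = ι ⊗ 1`);
* **`false_of_horizontal_pairedPrimitive`** — for a clean cuspidal `π` of `GL_n(𝔸_K)`, `n ≠ 0`, a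
  basic cocycle `η ∈ Z^{q+1}(𝔤, K_∞; W ⊗ E_λ)` which is not a coboundary admits NO
  `(𝔨 ⊕ ℝ·1)`-horizontal cochain `Ψ ∈ C^q(𝔤; W' ⊗ E_λ)` with `dΨ = (ι ⊗ 1) ∘ η`.

What remains of `Borel1983_coneClass_ne_zero` is thus exactly the analytic EXISTENCE statement:
if the cone class of `η` vanishes in `H^{q+1}(Γ; E_λ)` then such a `Ψ` (of moderate growth)
exists — de Rham's theorem on `Γ \ X⁺` with local coefficients plus Borel's regularization
`A_umg ≃ A` (Borel 1983, Thm. 3.2; Borel–Wallach VII 2.2–2.7, XIV 2.3).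
[cite: BorelWallach2000, II §2.2–2.5, XIV 2.3] [cite: Borel1983Regularization, Thm. 3.2]

## References

* A. Borel, N. Wallach (2000), II §2.2–2.5, XIV 2.3 (held). [BorelWallach2000]
* A. Borel, *Regularization theorems in Lie algebra cohomology. Applications*, Duke Math. J. 50
  (1983), Thm. 3.2. [Borel1983Regularization]
-/

noncomputable section

namespace Literature.NumberTheory.Automorphic

-- Mathlib idiom (as in `GKModules`): commutator bracket on matrix algebras and `Module.End`
attribute [local instance 100] LieRing.ofAssociativeRing

open scoped TensorProduct Classical _root_.Matrix ComplexConjugate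
open _root_.NumberField _root_.NumberField.InfinitePlace _root_.NumberField.mixedEmbedding Finset
open _root_.MeasureTheory

/-! ### Two-module tensor pairings -/

namespace Kuga

section SesqPairing

variable {W' W : Type*} [AddCommGroup W'] [Module ℂ W'] [AddCommGroup W] [Module ℂ W]

/-- A **sesquilinear pairing** `p : W' × W → ℂ` (conjugate-linear in the first variable, linear in
the second). [folklore] -/
structure IsSesqPairing (p : W' → W → ℂ) : Prop where
  add_left : ∀ x y z, p (x + y) z = p x z + p y z
  smul_left : ∀ (c : ℂ) x z, p (c • x) z = conj c * p x z
  add_right : ∀ x y z, p x (y + z) = p x y + p x z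
  smul_right : ∀ (c : ℂ) x y, p x (c • y) = c * p x y

namespace IsSesqPairing

variable {p : W' → W → ℂ} (h : IsSesqPairing p)
include h

/-- `p 0 z = 0`. [folklore] -/
theorem zero_left (z : W) : p 0 z = 0 := by
  have e := h.smul_left 0 0 z
  rwa [zero_smul, map_zero, zero_mul] at e

/-- `p x 0 = 0`. [folklore] -/
theorem zero_right (x : W') : p x 0 = 0 := by
  have e := h.smul_right 0 x 0
  rwa [zero_smul, zero_mul] at e

/-- Finite additivity in the first variable. [folklore] -/
theorem sum_left {σ : Type*} (s : Finset σ) (f : σ → W') (z : W) : p (∑ i ∈ s, f i) z = ∑ i ∈ s, p (f i) z := by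
  induction s using Finset.induction_on with
  | empty => rw [sum_empty, sum_empty, h.zero_left]
  | insert a s ha ih => rw [sum_insert ha, sum_insert ha, h.add_left, ih]

/-- Finite additivity in the second variable. [folklore] -/
theorem sum_right {σ : Type*} (s : Finset σ) (x : W') (f : σ → W) : p x (∑ i ∈ s, f i) = ∑ i ∈ s, p x (f i) := by
  induction s using Finset.induction_on with
  | empty => rw [sum_empty, sum_empty, h.zero_right]
  | insert a s ha ih => rw [sum_insert ha, sum_insert ha, h.add_right, ih]

/-- Subtraction in the second variable. [folklore] -/
theorem sub_right (x : W') (y z : W) : p x (y - z) = p x y - p x z := by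
  rw [sub_eq_add_neg, h.add_right, ← neg_one_smul ℂ z, h.smul_right, neg_one_mul, sub_eq_add_neg]

/-- **`Re p` as a real bilinear pairing** of the underlying real vector spaces
(`Module.complexToReal`). [cite: BorelWallach2000, II §2.2] -/
def rePairing : W' →ₗ[ℝ] W →ₗ[ℝ] ℝ :=
  LinearMap.mk₂ ℝ (fun x y => (p x y).re)
    (fun x x' y => by rw [h.add_left, Complex.add_re])
    (fun c x y => by rw [← Complex.coe_smul, h.smul_left, Complex.conj_ofReal, Complex.re_ofReal_mul, smul_eq_mul])
    (fun x y y' => by rw [h.add_right, Complex.add_re])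
    (fun c x y => by rw [← Complex.coe_smul, h.smul_right, Complex.re_ofReal_mul, smul_eq_mul])

/-- Unfolding. [folklore] -/
theorem rePairing_apply (x : W') (y : W) : h.rePairing x y = (p x y).re := rfl

end IsSesqPairing

/-- A positive Hermitian form is a sesquilinear pairing. [folklore] -/
theorem IsPosForm.isSesqPairing {ip : W → W → ℂ} (h : IsPosForm ip) : IsSesqPairing ip :=
  ⟨h.add_left, h.smul_left, h.add_right, h.smul_right⟩

end SesqPairing

section TensorPairing

variable {W' W E : Type*} [AddCommGroup W'] [Module ℂ W'] [AddCommGroup W] [Module ℂ W]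
  [AddCommGroup E] [Module ℂ E] {ι : Type*} [Fintype ι] [DecidableEq ι]
  (p : W' → W → ℂ) (b : Module.Basis ι ℂ E)

/-- **The tensor pairing `(W' ⊗ E) × (W ⊗ E) → ℂ`** attached to a pairing `p : W' × W → ℂ` and a
basis `b` of `E`: `⟨t', t⟩ = ∑_i p(u'_i, u_i)` for `t' = ∑ u'_i ⊗ b_i`, `t = ∑ u_i ⊗ b_i`.
[cite: BorelWallach2000, II §2.2] -/
def tensorPairing (t' : W' ⊗[ℂ] E) (t : W ⊗[ℂ] E) : ℂ :=
  ∑ i, p (coordT b t' i) (coordT b t i)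

/-- Unfolding. [folklore] -/
theorem tensorPairing_apply (t' : W' ⊗[ℂ] E) (t : W ⊗[ℂ] E) :
    tensorPairing p b t' t = ∑ i, p (coordT b t' i) (coordT b t i) :=
  rfl

variable {p}

/-- The tensor pairing is sesquilinear. [folklore] -/
theorem isSesqPairing_tensorPairing (hp : IsSesqPairing p) : IsSesqPairing (tensorPairing p b) where
  add_left x y z := by simp only [tensorPairing_apply, map_add, Pi.add_apply, hp.add_left, sum_add_distrib]
  smul_left c x z := by simp only [tensorPairing_apply, map_smul, Pi.smul_apply, hp.smul_left, mul_sum]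
  add_right x y z := by simp only [tensorPairing_apply, map_add, Pi.add_apply, hp.add_right, sum_add_distrib]
  smul_right c x y := by simp only [tensorPairing_apply, map_smul, Pi.smul_apply, hp.smul_right, mul_sum]

/-- **Transfer in the first slots**: `⟨(A' ⊗ 1) t', t⟩ = ⟨t', (A ⊗ 1) t⟩` whenever
`p(A' w', w) = p(w', A w)`. [cite: BorelWallach2000, II 2.2 (4)] -/
theorem tensorPairing_map_left_rTensor {A' : W' →ₗ[ℂ] W'} {A : W →ₗ[ℂ] W} (hA : ∀ w' w, p (A' w') w = p w' (A w))
    (t' : W' ⊗[ℂ] E) (t : W ⊗[ℂ] E) :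
    tensorPairing p b (TensorProduct.map A' LinearMap.id t') t = tensorPairing p b t' (TensorProduct.map A LinearMap.id t) := by
  simp only [tensorPairing_apply, coordT_rTensor, hA]

/-- **Transfer in the `E` slot**: `⟨(1 ⊗ C) t', t⟩ = ⟨t', (1 ⊗ C') t⟩` whenever the matrix of `C'`
in `b` is the conjugate transpose of that of `C`. [cite: BorelWallach2000, II 2.2 (5)] -/
theorem tensorPairing_map_left_lTensor (hp : IsSesqPairing p) {C C' : E →ₗ[ℂ] E}
    (hC : LinearMap.toMatrix b b C' = (LinearMap.toMatrix b b C)ᴴ) (t' : W' ⊗[ℂ] E) (t : W ⊗[ℂ] E) :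
    tensorPairing p b (TensorProduct.map LinearMap.id C t') t = tensorPairing p b t' (TensorProduct.map LinearMap.id C' t) := by
  simp only [tensorPairing_apply, coordT_lTensor, hp.sum_left, hp.sum_right, hp.smul_left, hp.smul_right, hC,
    Matrix.conjTranspose_apply, Complex.star_def]
  rw [sum_comm]

/-- The same for `b` orthonormal and `C'` an adjoint of `C`. [cite: BorelWallach2000, II 2.2 (5)] -/
theorem tensorPairing_map_left_lTensor_of_orthonormal (hp : IsSesqPairing p) {ipE : E → E → ℂ} (hE : IsPosForm ipE)
    (hb : ∀ i j, ipE (b i) (b j) = if i = j then 1 else 0) {C C' : E →ₗ[ℂ] E}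
    (hC : ∀ e e', ipE (C e) e' = ipE e (C' e')) (t' : W' ⊗[ℂ] E) (t : W ⊗[ℂ] E) :
    tensorPairing p b (TensorProduct.map LinearMap.id C t') t = tensorPairing p b t' (TensorProduct.map LinearMap.id C' t) :=
  tensorPairing_map_left_lTensor b hp (hE.toMatrix_adjoint b hb hC) t' t

/-- Naturality of the coordinates along a linear map `j : W → W'`: `coordT ((j ⊗ 1) t) = j ∘ coordT t`.
[folklore] -/
theorem coordT_map_left (j : W →ₗ[ℂ] W') (t : W ⊗[ℂ] E) (i : ι) :
    coordT b (TensorProduct.map j LinearMap.id t) i = j (coordT b t i) := by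
  induction t using TensorProduct.induction_on with
  | zero => simp only [map_zero, Pi.zero_apply]
  | tmul w e => rw [TensorProduct.map_tmul, LinearMap.id_apply, coordT_tmul, coordT_tmul, map_smul]
  | add x y hx hy => simp only [map_add, Pi.add_apply, hx, hy]

/-- **Compatibility with an inclusion**: if `p(j w, w₂) = ⟨w, w₂⟩_W` then
`⟨(j ⊗ 1) t, t₂⟩ = ⟨t, t₂⟩_{W ⊗ E}`. [folklore] -/
theorem tensorPairing_rTensor_of_extends {ip : W → W → ℂ} {j : W →ₗ[ℂ] W'} (hj : ∀ w w₂, p (j w) w₂ = ip w w₂)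
    (t t₂ : W ⊗[ℂ] E) :
    tensorPairing p b (TensorProduct.map j LinearMap.id t) t₂ = tensorForm ip b t t₂ := by
  simp only [tensorPairing_apply, tensorForm_apply, coordT_map_left, hj]

end TensorPairing

end Kuga

/-! ### The pairing `(W' ⊗ E_λ) × (W ⊗ E_λ) → ℝ` over the datum -/

namespace ConeDictionary

open Literature.Algebra.Lie.ChevalleyEilenberg

variable {n : ℕ} {K : Type} [Field K] [NumberField K] {hcpt : isCompact_glFiniteIntegralLevel n K}
  (π : AutomorphicRepData (AutomorphyDatum.gl n K hcpt)) (lam : (K →+* ℂ) → Fin n → ℤ)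
  {W' : Type*} [AddCommGroup W'] [Module ℂ W'] (ρ' : (AutomorphyDatum.gl n K hcpt).arch.lie →ₗ⁅ℝ⁆ Module.End ℂ W')

/-- The Lie module `W' ⊗ E_λ` of the auxiliary `W'` (Leibniz action). [cite: BorelWallach2000, I §1.3] -/
abbrev Carrier' : Type _ :=
  GKCarrier (AutomorphyDatum.gl n K hcpt).arch (GKTensor.lie (AutomorphyDatum.gl n K hcpt).arch ρ' (σ𝔤S hcpt lam))

/-- **The pairing `p ⊗ adm` on `(W' ⊗ E_λ) × (W ⊗ E_λ)`** along the orthonormal `archBasis`.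
[cite: BorelWallach2000, II §2.2] -/
def pairingForm (p : W' → π.W → ℂ) :
    W' ⊗[ℂ] ResGLnCohomology.CoeffModule ℂ n K lam → π.W ⊗[ℂ] ResGLnCohomology.CoeffModule ℂ n K lam → ℂ :=
  Kuga.tensorPairing p (AdmissibleForm.archBasis n K lam)

/-- The pairing `p ⊗ adm` is sesquilinear. [folklore] -/
theorem isSesqPairing_pairingForm {p : W' → π.W → ℂ} (hp : Kuga.IsSesqPairing p) :
    Kuga.IsSesqPairing (pairingForm π lam p) :=
  Kuga.isSesqPairing_tensorPairing _ hp

set_option maxHeartbeats 800000 in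
set_option synthInstance.maxHeartbeats 200000 in
-- the datum's `arch` is `archGroupGL n K` only definitionally; instance searches are deep here
/-- `ρ'(X) ⊗ 1` against `π(X) ⊗ 1`: skewness of `p` along `X` transfers to the tensor pairing.
[cite: BorelWallach2000, II 2.2 (4)] -/
theorem pairingForm_rTensor_left {p : W' → π.W → ℂ} (hp : Kuga.IsSesqPairing p)
    (X : (AutomorphyDatum.gl n K hcpt).arch.lie) (hskew : ∀ (w' : W') (w : π.W), p (ρ' X w') w = -p w' (π.lieDerivW X w))
    (a : W' ⊗[ℂ] ResGLnCohomology.CoeffModule ℂ n K lam) (b : π.W ⊗[ℂ] ResGLnCohomology.CoeffModule ℂ n K lam) :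
    pairingForm π lam p ((ρ' X).rTensor _ a) b = -pairingForm π lam p a ((π.lieRepW X).rTensor _ b) := by
  have hA : ∀ (w' : W') (w : π.W), p (ρ' X w') w = p w' (((-1 : ℂ) • π.lieRepW X) w) := fun w' w => by
    rw [hskew, LinearMap.smul_apply, AutomorphicRepData.lieRepW_apply, hp.smul_right, neg_one_mul]
  have h := Kuga.tensorPairing_map_left_rTensor (AdmissibleForm.archBasis n K lam) (p := p) hA a b
  rw [TensorProduct.map_smul_left, LinearMap.smul_apply, (Kuga.isSesqPairing_tensorPairing _ hp).smul_right,
    neg_one_mul] at h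
  exact h

/-- `1 ⊗ dE_λ(X)` is self-adjoint across the pairing for `X` Hermitian. [cite: BorelWallach2000, II 2.2 (5)] -/
theorem pairingForm_lTensor_left {p : W' → π.W → ℂ} (hp : Kuga.IsSesqPairing p)
    (X : (AutomorphyDatum.gl n K hcpt).arch.lie) (hX : (X : Matrix (Fin n) (Fin n) (mixedSpace K))ᴴ = X)
    (a : W' ⊗[ℂ] ResGLnCohomology.CoeffModule ℂ n K lam) (b : π.W ⊗[ℂ] ResGLnCohomology.CoeffModule ℂ n K lam) :
    pairingForm π lam p ((σ𝔤S hcpt lam X).lTensor W' a) b = pairingForm π lam p a ((σ𝔤S hcpt lam X).lTensor π.W b) :=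
  Kuga.tensorPairing_map_left_lTensor_of_orthonormal (AdmissibleForm.archBasis n K lam) hp
    (AdmissibleForm.isPosForm_archForm n K lam) (AdmissibleForm.basisForm_basis (AdmissibleForm.archBasis n K lam))
    (AdmissibleForm.archForm_archCoeffLie_left_of_hermitian n K lam hX) a b

set_option maxHeartbeats 800000 in
set_option synthInstance.maxHeartbeats 200000 in
-- as above
/-- **The adjunction across the pairing**: `⟨X·a', b⟩ = -⟨a', (π(X) ⊗ 1 - 1 ⊗ dE_λ(X)) b⟩` for `X`
Hermitian along which `p` is skew. [cite: BorelWallach2000, II 2.2 (4)–(5), 2.5] -/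
theorem pairingForm_lie_left {p : W' → π.W → ℂ} (hp : Kuga.IsSesqPairing p)
    (X : (AutomorphyDatum.gl n K hcpt).arch.lie) (hX : (X : Matrix (Fin n) (Fin n) (mixedSpace K))ᴴ = X)
    (hskew : ∀ (w' : W') (w : π.W), p (ρ' X w') w = -p w' (π.lieDerivW X w))
    (a : W' ⊗[ℂ] ResGLnCohomology.CoeffModule ℂ n K lam) (b : π.W ⊗[ℂ] ResGLnCohomology.CoeffModule ℂ n K lam) :
    pairingForm π lam p (GKTensor.lie (AutomorphyDatum.gl n K hcpt).arch ρ' (σ𝔤S hcpt lam) X a) b =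
      -pairingForm π lam p a
        ((π.lieRepW X).rTensor (ResGLnCohomology.CoeffModule ℂ n K lam) b - (σ𝔤S hcpt lam X).lTensor π.W b) := by
  rw [GKTensor.lie_apply, LinearMap.add_apply, (isSesqPairing_pairingForm π lam hp).add_left,
    (isSesqPairing_pairingForm π lam hp).sub_right, pairingForm_rTensor_left π lam ρ' hp X hskew,
    pairingForm_lTensor_left π lam hp X hX]
  ring

/-- **`P = Re (p ⊗ adm)`** as a real bilinear pairing `Carrier' × Carrier → ℝ`.
[cite: BorelWallach2000, II §2.2] -/
def pairP {p : W' → π.W → ℂ} (hp : Kuga.IsSesqPairing p) : Carrier' lam ρ' →ₗ[ℝ] Carrier π lam →ₗ[ℝ] ℝ :=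
  (Kuga.isSesqPairing_tensorPairing (AdmissibleForm.archBasis n K lam) hp).rePairing

/-- Unfolding. [folklore] -/
theorem pairP_apply {p : W' → π.W → ℂ} (hp : Kuga.IsSesqPairing p) (a : Carrier' lam ρ') (b : Carrier π lam) :
    pairP π lam ρ' hp a b = (pairingForm π lam p a b).re :=
  rfl

set_option maxHeartbeats 800000 in
set_option synthInstance.maxHeartbeats 200000 in
-- as above
/-- **Hypothesis `hadjP`**: `P(⁅X, a'⁆, b) = -P(a', s(X) b)` for `X` Hermitian along which `p` is
skew (integration by parts against a cusp form). [cite: BorelWallach2000, II 2.2 (4)–(5), 2.5] -/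
theorem pairP_lie {p : W' → π.W → ℂ} (hp : Kuga.IsSesqPairing p)
    (X : (AutomorphyDatum.gl n K hcpt).arch.lie) (hX : (X : Matrix (Fin n) (Fin n) (mixedSpace K))ᴴ = X)
    (hskew : ∀ (w' : W') (w : π.W), p (ρ' X w') w = -p w' (π.lieDerivW X w))
    (a : Carrier' lam ρ') (b : Carrier π lam) :
    pairP π lam ρ' hp ⁅X, a⁆ b = -pairP π lam ρ' hp a (kugaS π lam X b) := by
  change (pairingForm π lam p (GKTensor.lie (AutomorphyDatum.gl n K hcpt).arch ρ' (σ𝔤S hcpt lam) X a) b).re =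
    -(pairingForm π lam p a
      ((π.lieRepW X).rTensor (ResGLnCohomology.CoeffModule ℂ n K lam) b - (σ𝔤S hcpt lam X).lTensor π.W b)).re
  rw [pairingForm_lie_left π lam ρ' hp X hX hskew, Complex.neg_re]

/-- **The inclusion `j = ι ⊗ 1 : W ⊗ E_λ → W' ⊗ E_λ`** as a real-linear map of the carriers.
[folklore] -/
def inclT (jW : π.W →ₗ[ℂ] W') : Carrier π lam →ₗ[ℝ] Carrier' lam ρ' :=
  ((jW.rTensor (ResGLnCohomology.CoeffModule ℂ n K lam)).restrictScalars ℝ :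
    π.W ⊗[ℂ] ResGLnCohomology.CoeffModule ℂ n K lam →ₗ[ℝ] W' ⊗[ℂ] ResGLnCohomology.CoeffModule ℂ n K lam)

/-- **Hypothesis `hj`**: `P(j a, b) = B(a, b)` when `p` extends `⟨ , ⟩_W` along `jW`.
[cite: BorelWallach2000, II §2.2] -/
theorem pairP_inclT {p : W' → π.W → ℂ} (hp : Kuga.IsSesqPairing p) {ip : π.W → π.W → ℂ} (hip : Kuga.IsPosForm ip)
    {jW : π.W →ₗ[ℂ] W'} (hj : ∀ w w₂, p (jW w) w₂ = ip w w₂) (a b : Carrier π lam) :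
    pairP π lam ρ' hp (inclT π lam ρ' jW a) b = kugaB π lam hip a b := by
  rw [pairP_apply, kugaB_apply]
  exact congrArg Complex.re (Kuga.tensorPairing_rTensor_of_extends (AdmissibleForm.archBasis n K lam) hj a b)

/-! ### Step 4: no horizontal paired primitive -/

set_option maxHeartbeats 800000 in
set_option synthInstance.maxHeartbeats 200000 in
-- as above
/-- **A basic non-trivial cuspidal cocycle has no horizontal paired primitive.**  Let `π` be a clean
cuspidal automorphic representation of `GL_n(𝔸_K)` (`W ≤ 𝒜₀`, `W' = ⊥`), `n ≠ 0`, `μ` an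
automorphic measure and `T` a unitary twist (Petersson form `⟨ , ⟩ = T.pet μ`).  Let `W'` be ANY
complex Lie module of `𝔤 = 𝔤𝔩ₙ(K_∞)` with a sesquilinear pairing `p : W' × W → ℂ` extending `⟨ , ⟩`
along a linear `jW : W → W'` and skew along the trace-zero Hermitian `x i`
(`p(x_i w', w) = -p(w', x_i w)`: integration by parts of a function of moderate growth against a
cusp form).  Then a basic cocycle `η ∈ Z^{q+1}(𝔤, K_∞; W ⊗ E_λ)` (`i_Z η = 0`) which is not a
coboundary admits no `(𝔨 ⊕ ℝ·1)`-horizontal `Ψ ∈ C^q(𝔤; W' ⊗ E_λ)` with `dΨ = (jW ⊗ 1) ∘ η` —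
the energy argument `ChevalleyEilenbergPairedPrimitive.eq_zero_of_pairedPrimitive` with Kuga's
lemma (`coclosed_of_cuspidal`: the Casimir scalars of `W` and `E_λ` and Wigner's lemma) and the
Petersson positivity.  Borel's theorem `Borel1983_coneClass_ne_zero` is this statement plus the
EXISTENCE of such a `Ψ` of moderate growth when the cone class of `η` dies in `H^{q+1}(Γ; E_λ)`
(de Rham + regularization). [cite: BorelWallach2000, II §2.2–2.5, XIV 2.3]
[cite: Borel1983Regularization, Thm. 3.2] -/
theorem false_of_horizontal_pairedPrimitive [NeZero n] (πc : CuspidalAutomorphicRepData n K hcpt) (hW' : πc.1.W' = ⊥)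
    (S : Finset {w : InfinitePlace K // w.IsReal})
    (μ : Measure (AdelicGroupData.gl n K).automorphicQuotient) [(AdelicGroupData.gl n K).IsAutomorphicMeasure μ]
    (T : πc.1.UnitaryTwist)
    (ρ' : (AutomorphyDatum.gl n K hcpt).arch.lie →ₗ⁅ℝ⁆ Module.End ℂ W') {p : W' → πc.1.W → ℂ} (hp : Kuga.IsSesqPairing p)
    (hskew : ∀ (i : Fin (ResGLnCartan.pZeroDim n K)) (w' : W') (w : πc.1.W),
      p (ρ' (xD n K hcpt i) w') w = -p w' (πc.1.lieDerivW (xD n K hcpt i) w))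
    {jW : πc.1.W →ₗ[ℂ] W'} (hj : ∀ w w₂, p (jW w) w₂ = T.pet μ w w₂)
    (q : ℕ) {η : Cochain πc.1 lam (q + 1)} (hZ : η ∈ (gkComplexLS πc.1 S lam).cocycles (q + 1))
    (hB : η ∉ (gkComplexLS πc.1 S lam).coboundaries (q + 1))
    (hins : ins q (⟨1, trivial⟩ : (AutomorphyDatum.gl n K hcpt).arch.lie) η = 0)
    {Ψ : Literature.Algebra.Lie.ChevalleyEilenberg.Cochain ℝ (𝔤D n K hcpt) (Carrier' lam ρ') q}
    (hΨ : Ψ ∈ horizontal (M := Carrier' lam ρ') (kPrimeD n K hcpt) q)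
    (hprim : d ℝ (𝔤D n K hcpt) (Carrier' lam ρ') q Ψ = post (𝔤D n K hcpt) (inclT πc.1 lam ρ' jW) (q + 1) η) :
    False := by
  have hip := T.isPosForm_pet μ
  have hskewW : ∀ (i : Fin (ResGLnCartan.pZeroDim n K)) (v v' : πc.1.W),
      T.pet μ (πc.1.lieDerivW (xD n K hcpt i) v) v' = -T.pet μ v (πc.1.lieDerivW (xD n K hcpt i) v') :=
    fun i v v' => T.pet_lieDerivW_left μ (xD n K hcpt i) (ResGLnCartan.mixedTrace_trace_x n K i) v v'
  obtain ⟨c, hc⟩ := exists_op_lieRepW_eq_smul πc.1 hW'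
  obtain ⟨c', hc'⟩ := exists_op_σ𝔤S_eq_smul n K hcpt lam
  have hcc := d_eq_zero_and_coclosed_of_not_mem_coboundaries πc.1 S lam hip hskewW hc hc' q hZ hB hins
  have hZ' := ((gkComplexLS πc.1 S lam).mem_cocycles_iff (q + 1) η).1 hZ
  have hrel := mem_rel_kPrimeD_of_basic_cocycle πc.1 S lam q hZ'.1 hins hZ'.2
  have hzero : η = 0 :=
    eq_zero_of_pairedPrimitive (kugaB_self_nonneg πc.1 lam hip) (eq_zero_of_kugaB_self πc.1 lam hip)
      (kugaD_hspan n K hcpt) (kugaD_hxx n K hcpt)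
      (fun i a b => pairP_lie πc.1 lam ρ' hp (xD n K hcpt i) (conjTranspose_xD n K hcpt i) (hskew i) a b)
      (fun a b => pairP_inclT πc.1 lam ρ' hp hip hj a b) q (Submodule.mem_inf.1 hrel).2 hcc.2 hΨ hprim
  exact hB (hzero ▸ Submodule.zero_mem _)

end ConeDictionary

end Literature.NumberTheory.Automorphic

end
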